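import Mathlib

/-!
# Conjugate-symplectic and conjugate-orthogonal characters: the closure rules (kernel witness for
the standard fact (A2))

Blind cell `pub-hodge-repro2`, seat p4, Tier-5 support. README §8(d): this file uses an
L-value-free non-vanishing device: NO (a kernel check of a standard fact already on the cell's
record).

The standard fact (A2) of `route/T5-route-2.md` §N5.11.7 (owner route-2, sub-step N5) reads: «a
character ξ of E_v^× is conjugate-symplectic iff ξ|_{F_v^×} = η_v («symplectic type» of [FM21]
p0003 l. 18), conjugate-orthogonal iff ξ|_{F_v^×} = 1; inverses of conjugate-symplectic characters
are conjugate-symplectic, products of two are conjugate-orthogonal, and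
(conjugate-orthogonal)·(conjugate-symplectic) is conjugate-symplectic (η_v² = 1)».

We take the restriction conditions as the definitions — «orthogonal type» = `ξ.restrict F = 1`,
«symplectic type» = `ξ.restrict F = η` (this is [FM21]'s wording; its equivalence with the
conjugate-self-duality definition of GGP is the printed convention the ledger records, not re-proved
here) — and kernel-check the closure rules for an arbitrary abelian group `G` (= `E_v^×`), a
subgroup `F` (= `F_v^×`), a target abelian group `Q` (= `ℂ^×`) and a quadratic character
`η : F →* Q` (`η * η = 1`, the quadratic character of `E_v/F_v`):

* `restrict_one`, `restrict_inv_eq_one`, `restrict_mul_eq_one` — the orthogonal-type characters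
  form a subgroup (`orthogonalTypeSubgroup`, the kernel of restriction);
* `restrict_inv_eq_of_sq_eq_one` (inverse of symplectic is symplectic, uses `η² = 1`),
  `restrict_mul_eq_one_of_sq_eq_one` (two symplectic ⇒ orthogonal), `restrict_div_eq_one`,
  `restrict_mul_eq_of_eq_one_left` / `_right` (orthogonal · symplectic ⇒ symplectic);
* `restrict_eq_iff_div` / `exists_restrict_eq_one_and_eq_mul_iff` — the symplectic-type characters
  form a coset of the orthogonal-type subgroup (once one of them exists).

Mathlib only; no sorry; axioms ⊆ {propext, Classical.choice, Quot.sound}.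
-/

namespace Summit.Ventures.HodgeRepro2.T5ConjugateTypeCharacters

variable {G : Type*} [CommGroup G] {Q : Type*} [CommGroup Q] {F : Subgroup G}

/-- Restriction to `F` is multiplicative. -/
theorem restrict_mul (ξ₁ ξ₂ : G →* Q) : (ξ₁ * ξ₂).restrict F = ξ₁.restrict F * ξ₂.restrict F :=
  MonoidHom.ext fun _ => rfl

/-- Restriction to `F` commutes with inverses. -/
theorem restrict_inv (ξ : G →* Q) : ξ⁻¹.restrict F = (ξ.restrict F)⁻¹ :=
  MonoidHom.ext fun _ => rfl

/-- Restriction to `F` commutes with quotients. -/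
theorem restrict_div (ξ₁ ξ₂ : G →* Q) : (ξ₁ / ξ₂).restrict F = ξ₁.restrict F / ξ₂.restrict F :=
  MonoidHom.ext fun _ => rfl

/-- The trivial character restricts to the trivial character (orthogonal type). -/
theorem restrict_one : (1 : G →* Q).restrict F = 1 :=
  MonoidHom.ext fun _ => rfl

/-- Inverses of orthogonal-type characters are of orthogonal type. -/
theorem restrict_inv_eq_one {ξ : G →* Q} (h : ξ.restrict F = 1) : ξ⁻¹.restrict F = 1 := by
  rw [restrict_inv, h, inv_one]

/-- Products of orthogonal-type characters are of orthogonal type. -/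
theorem restrict_mul_eq_one {ξ₁ ξ₂ : G →* Q} (h₁ : ξ₁.restrict F = 1) (h₂ : ξ₂.restrict F = 1) :
    (ξ₁ * ξ₂).restrict F = 1 := by
  rw [restrict_mul, h₁, h₂, one_mul]

/-- The orthogonal-type characters (`ξ|_F = 1`) form a subgroup of the character group of `G`:
the kernel of restriction to `F`. -/
def orthogonalTypeSubgroup (F : Subgroup G) (Q : Type*) [CommGroup Q] : Subgroup (G →* Q) where
  carrier := {ξ | ξ.restrict F = 1}
  one_mem' := restrict_one
  mul_mem' h₁ h₂ := restrict_mul_eq_one h₁ h₂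
  inv_mem' h := restrict_inv_eq_one h

/-- Membership in the orthogonal-type subgroup. -/
theorem mem_orthogonalTypeSubgroup {ξ : G →* Q} :
    ξ ∈ orthogonalTypeSubgroup F Q ↔ ξ.restrict F = 1 := Iff.rfl

variable {η : F →* Q}

/-- A quadratic character is its own inverse. -/
theorem inv_eq_self_of_sq_eq_one (hη : η * η = 1) : η⁻¹ = η :=
  inv_eq_of_mul_eq_one_right hη

/-- Inverses of symplectic-type characters (`ξ|_F = η`) are of symplectic type (uses `η² = 1`). -/
theorem restrict_inv_eq_of_sq_eq_one (hη : η * η = 1) {ξ : G →* Q} (h : ξ.restrict F = η) :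
    ξ⁻¹.restrict F = η := by
  rw [restrict_inv, h, inv_eq_self_of_sq_eq_one hη]

/-- The product of two symplectic-type characters is of orthogonal type (uses `η² = 1`). -/
theorem restrict_mul_eq_one_of_sq_eq_one (hη : η * η = 1) {ξ₁ ξ₂ : G →* Q}
    (h₁ : ξ₁.restrict F = η) (h₂ : ξ₂.restrict F = η) : (ξ₁ * ξ₂).restrict F = 1 := by
  rw [restrict_mul, h₁, h₂, hη]

/-- The quotient of two symplectic-type characters is of orthogonal type (no condition on `η`). -/
theorem restrict_div_eq_one {ξ₁ ξ₂ : G →* Q} (h₁ : ξ₁.restrict F = η) (h₂ : ξ₂.restrict F = η) :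
    (ξ₁ / ξ₂).restrict F = 1 := by
  rw [restrict_div, h₁, h₂, div_self']

/-- (orthogonal type) · (symplectic type) is of symplectic type. -/
theorem restrict_mul_eq_of_eq_one_left {ξ₁ ξ₂ : G →* Q} (h₁ : ξ₁.restrict F = 1)
    (h₂ : ξ₂.restrict F = η) : (ξ₁ * ξ₂).restrict F = η := by
  rw [restrict_mul, h₁, h₂, one_mul]

/-- (symplectic type) · (orthogonal type) is of symplectic type. -/
theorem restrict_mul_eq_of_eq_one_right {ξ₁ ξ₂ : G →* Q} (h₁ : ξ₁.restrict F = η)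
    (h₂ : ξ₂.restrict F = 1) : (ξ₁ * ξ₂).restrict F = η := by
  rw [restrict_mul, h₁, h₂, mul_one]

/-- Given one symplectic-type character `ξ₀`, a character `ξ` is of symplectic type iff `ξ / ξ₀`
is of orthogonal type: the symplectic-type characters form a coset of `orthogonalTypeSubgroup`. -/
theorem restrict_eq_iff_div {ξ₀ : G →* Q} (h₀ : ξ₀.restrict F = η) (ξ : G →* Q) :
    ξ.restrict F = η ↔ (ξ / ξ₀).restrict F = 1 := by
  constructor
  · intro h
    exact restrict_div_eq_one h h₀
  · intro h
    have : ξ = ξ / ξ₀ * ξ₀ := by rw [div_mul_cancel]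
    rw [this]
    exact restrict_mul_eq_of_eq_one_left h h₀

/-- The same, as a parametrisation: the symplectic-type characters are exactly the `ξ₀ · ξ'` with
`ξ'` of orthogonal type. -/
theorem exists_restrict_eq_one_and_eq_mul_iff {ξ₀ : G →* Q} (h₀ : ξ₀.restrict F = η)
    (ξ : G →* Q) : (∃ ξ' : G →* Q, ξ'.restrict F = 1 ∧ ξ = ξ₀ * ξ') ↔ ξ.restrict F = η := by
  constructor
  · rintro ⟨ξ', hξ', rfl⟩
    exact restrict_mul_eq_of_eq_one_right h₀ hξ'
  · intro h
    refine ⟨ξ / ξ₀, restrict_div_eq_one h h₀, ?_⟩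
    rw [mul_div_cancel]

end Summit.Ventures.HodgeRepro2.T5ConjugateTypeCharacters
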